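import Literature.MathematicalPhysics.QuantumFieldTheory.Balaban1983to89.B9Thm39CinvAtCoverAbove

/-!
# `Balaban1983to89.B9Thm39CinvAtCoverLarge` — [Balaban1985BackgroundPropagators] THEOREM 3.9 pp. 411–413 ⇒ THEOREM 3.2 (3.48) p. 398 FOR
# `C(U) = (Q′G′²Q′*)⁻¹(U)` AT THE CUBE COVER OF RECORD, «FOR M SUFFICIENTLY LARGE» IN FULL: the located smallness `(θ₁+θ₂+θ₃)c₁ < 1` of FILE 12 DISCHARGED above a
# threshold depending only on the constants, and (3.48)'s constant made explicit and member-independent (cell `lit-balaban`, G-B9-LETTERS module M5.6 FILE 13,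
# seat p21 gen 33)

statement-level skeleton of published theorems with citation tags; proofs where landed; nothing here is a claim about the Yang–Mills mass gap

CITATION HEADER (lean-in-tree rule).  B9 = T. Bałaban, *Propagators for lattice gauge theories in a background field*, Commun. Math. Phys. **99** (1985)
389–434: p. 411 «By the same estimates as in [4], especially (2.83)–(2.85), we can see that the operator R is small … The characteristic function 1 − □̃ … restrict a
kernel of the term to points separated at least by a distance MLʲη … Hence the part of the exponential factor can be estimated by e^{−¼δ₀M}»; p. 412 (3.97) «the usual
factors multiplied by e^{−2δ₀M} … estimated by (2δ₀M)⁻¹», «already localized and give small factors O(M⁻¹)»; p. 413 Theorem 3.9 «For M sufficiently large … This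
theorem implies Theorem 3.2»; p. 398 Theorem 3.2 (3.48) «|(Q′(U)G′²(U)Q′*(U))⁻¹(y, y′)| ≦ B₀(Lʲη)⁻⁴(L^{j′}η)^{−d}e^{−δ₀d(y,y′)}, y, y′ ∈ 𝔅».  [4] = [Balaban1984PropagatorsII]
(2.85)–(2.87) p. 238 («‖R‖ ≦ ½ and (Q′G′²Q′*)⁻¹ = C(I − R)⁻¹»), Lemma 2.1 (2.66) p. 234.  Rows B9.Thm3.9 × B9.Thm3.2 × B4.Eq2.85 (cells only; no row head changes).

WHY THIS FILE.  FILE 12 (`B9Thm39CinvAtCoverAbove.cinv_cover_above`) leaves ONE located hypothesis of the «M sufficiently large» kind: the smallness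
`(θ₁+θ₂+θ₃)·c₁(d′, ρδ₀, α′) < 1` of the three sums of (3.95), with `θ₁ = A₁e^{−a_sepδ₀M/(2L²)}` (separation), `θ₂ = A₂e^{−δ₀M/L²}` ((3.97)), `θ₃ = A₃/M` (the `O(M⁻¹)`
commutator), `A₁, A₂, A₃` depending only on the constants (`M₂Σ‖b_j‖`, `B_G`, `B₀`, `κ_D`, `α_cδ₀`, `s_T`, `L`, `d`, the door exponents).  THIS FILE discharges it: with
`e^{−x} ≦ 1/x` each `θ_m c₁ ≦ 1/6` once `M ≧ 6A_mc₁/a_m`, so `(θ₁+θ₂+θ₃)c₁ ≦ ½` (print's «‖R‖ ≦ ½») and `(1 − (θ₁+θ₂+θ₃)c₁)⁻¹ ≦ 2` — giving (3.48) with the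
MEMBER-INDEPENDENT constant `K = 2·3·5^{d+1}·B₀·c₁(d′, ρδ₀, α′)` for every member above one threshold, every analytic input still displayed per member.

WHAT IS PROVED (all `theorem`s, 0 `def`, 0 sorry, 0 new named facts).
* §1 arithmetic: `term_exp_small` (`e^{−x} ≦ x⁻¹` inline), `term_inv_small` (the `1/6` bounds), `smallness_shape` (FILE 12's three `θ`-expressions sum to
  `≦ ½` against `c₁` above the explicit thresholds), `DsepT_eq_div` (`D_sep = M/(2L²)`), `lipT_eq` (`ℓ₁ = 2s_T·M⁻¹`).
* §2 ★★★ `cinv_cover_large` — for the rate data of FILE 12 and the constants `B_G, B₀, κ_D ≧ 0`, `a_sep > 0`, `α_cδ₀ > 0`, the splits and the target rate: THERE ARE `M_L`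
  and `K ≧ 0` such that for EVERY member `i` with `M_L ≦ M_i` and every per-member datum (M5.5's `EBlock`s of `G′`, `G′_□` with constants `B_G, δ_G`; the section `ιB`;
  `IsUnit XY`; contractive transporters; the cube letters `C_□` with `hloc` and un-localized (3.48) blocks of constant `B₀`, rate `bδ₀`; the LOCALIZED [2]-difference
  majorants `hD` with constant `κ_De^{−2δ₀D_sep}`, rate `a_Dδ₀`):  `conj b ((η²η²)⁻¹•(Q′G′²Q′*)⁻¹(U)) ≺ K·ℓ(a)⁻⁴·e^{−(1−α′)ρδ₀d(a,a′)}` — Theorem 3.2's (3.48) with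
  `B₀ ↦ K`, `δ₀ ↦ (1−α′)ρδ₀`, in def-Y's lattice units.

HONEST SCOPE / NOT CLAIMED.  FILE 12's scope; now NO located smallness remains: «M sufficiently large» is the existential threshold `M_L` (door construction + the three
explicit thresholds; no numerical `M`).  Displayed per member, as printed inputs of Theorem 3.9's mechanism: M5.5's `EBlock`s (Theorem 3.1 for `G′(U)`, `G′_□(U)` —
above M5.5's own displayed inputs), the cube letters (Cor. 3.6 for `C_□`, M5.2-E), the localized [2]-difference estimate (GAP G-B9-05 — NOT derived in the tree),
`IsUnit XY` (w1's `isUnit_XY_parSymY` at the members), transporter/coordinate bounds.  Sup-entry (3.48) only; finite 𝕋 members of the k-level V1 family; nothing continuum,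
nothing about the mass gap; NOT summit progress.  RELATED, NOT DUPLICATED: FILE 12 (USED BY NAME), r06's scalar `B9Eq395Small.term397_small_factor`/`thirdSum_small_factor`
(the same `O(M⁻¹)` remarks on the scalar carrier).  Searched 2026-08-28: `lean search 'CinvAtCoverLarge|cinv_cover_large' --decl` = ∅.
-/

noncomputable section

namespace Literature.MathematicalPhysics.QuantumFieldTheory.Balaban1983to89.B9Thm39CinvAtCoverLarge

open Node00 B9CubeLettersInvReadings
open B6Cover236MultiLevelBlocks (cubes)
open B6Cover236MultiLevelTorusBlocks (hB cubeIndT)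
open B6Partition118KLevelTorusBinders (sLipT sLipT_nonneg)
open B6Ineq2142KLevelV1 (β)
open B6KLevelCensusIndexV1 (KIdx)
open B6RandomWalk (HasMajorant hasMajorant_mono)
open B9Thm34Ext (toB6)
open B9FromB6 (EBlock)
open B9GeoNormsKLevelV1 (geo9K)
open B9GeoLemma21KLevelV1 (one_le_Mh)
open B9Eq352DivFormLetters (conj)
open B9Thm37CubeCoverCommutators (cutMulY)
open B9Thm37CubeCoverCommutatorSizes (four_le_P')
open B9Thm39CinvAtCover (chiBigT DsepT lipT)
open B9Thm39CinvAtCoverAbove (cinv_cover_above)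

variable {d ℓ : ℕ} {hd : 1 ≤ d + 1} {hL : Odd (ℓ + 1) ∧ 1 < ℓ + 1} {b₀ b₁ : ℝ}
variable {𝔸 : Type} [NormedRing 𝔸] [NormedAlgebra ℂ 𝔸] [CompleteSpace 𝔸]
variable {ι : Type} [Fintype ι] [DecidableEq ι]

/-! ## §1 Arithmetic of «M sufficiently large» -/

/-- an exponentially small term against the threshold `6Kc/a ≦ M`: `K·e^{−aM}·c ≦ 1/6` (via `e^{−x} ≦ x⁻¹`, from `x + 1 ≦ eˣ` — the tree's
`Hamburger1921.exp_neg_le_inv` states the same elementary inequality in another topic; re-derived inline here to keep the import cone inside [B9]).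
[cite: Balaban1985BackgroundPropagators, p.411 («estimated by e^{−¼δ₀M}»), (3.97) p.412 («estimated by (2δ₀M)⁻¹»), bookkeeping] -/
theorem term_exp_small {K c a M : ℝ} (hK : 0 ≤ K) (hc : 0 ≤ c) (ha : 0 < a) (hM : 0 < M) (hT : 6 * K * c / a ≤ M) :
    K * Real.exp (-(a * M)) * c ≤ 6⁻¹ := by
  have h1 : Real.exp (-(a * M)) ≤ (a * M)⁻¹ := by
    rw [Real.exp_neg]
    exact inv_anti₀ (mul_pos ha hM) ((le_add_of_nonneg_right zero_le_one).trans (Real.add_one_le_exp (a * M)))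
  have h2 : K * Real.exp (-(a * M)) * c ≤ K * (a * M)⁻¹ * c := mul_le_mul_of_nonneg_right (mul_le_mul_of_nonneg_left h1 hK) hc
  have h3 : 6 * K * c ≤ M * a := (div_le_iff₀ ha).1 hT
  have h4 : K * (a * M)⁻¹ * c ≤ 6⁻¹ := by
    rw [show K * (a * M)⁻¹ * c = (K * c) / (a * M) by ring, div_le_iff₀ (mul_pos ha hM)]
    nlinarith [h3]
  exact h2.trans h4

/-- an `O(M⁻¹)` term against the threshold `6Kc ≦ M`: `K·M⁻¹·c ≦ 1/6`. [cite: Balaban1985BackgroundPropagators, p.412 («give small factors O(M⁻¹)»), bookkeeping] -/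
theorem term_inv_small {K c M : ℝ} (hM : 0 < M) (hT : 6 * K * c ≤ M) : K * M⁻¹ * c ≤ 6⁻¹ := by
  rw [show K * M⁻¹ * c = (K * c) / M by ring, div_le_iff₀ hM]
  nlinarith [hT]

/-- **THE THREE SUMS OF (3.95) ARE `≦ ½` AGAINST `c₁` ABOVE THE EXPLICIT THRESHOLDS** (print: «the operator R is small», [4] «‖R‖ ≦ ½»): in FILE 12's shapes
`θ₁ = N(P·B₀·L⁴·c_b·e^{−a_sepδ₀D})`, `θ₂ = N(κ_D·e^{−2δ₀D}·B₀·L⁴·c_b)`, `θ₃ = N((ℓ₁(α_cδ₀)⁻¹)·P·B₀·L⁴·c_b)` with `a_sepδ₀D = a₁M`, `2δ₀D = a₂M`, `ℓ₁ = 2s·M⁻¹`: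
`M ≧ 6K₁c/a₁, 6K₂c/a₂, 6K₃c` ⟹ `(θ₁+θ₂+θ₃)c ≦ ½`. [cite: Balaban1985BackgroundPropagators, (3.95) p.411 + (3.97) p.412; Balaban1984PropagatorsII, (2.85) p.238] -/
theorem smallness_shape {N P B₀ L4 cb κD c asep δ₀ αc D lip s M a₁ a₂ K₁ K₂ K₃ : ℝ}
    (hK₁0 : 0 ≤ K₁) (hK₂0 : 0 ≤ K₂) (hc : 0 ≤ c) (ha₁ : 0 < a₁) (ha₂ : 0 < a₂) (hM : 0 < M)
    (hD₁ : asep * δ₀ * D = a₁ * M) (hD₂ : 2 * δ₀ * D = a₂ * M) (hlip : lip = 2 * s * M⁻¹)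
    (hK₁ : K₁ = N * (P * B₀ * L4 * cb)) (hK₂ : K₂ = N * (κD * B₀ * L4 * cb)) (hK₃ : K₃ = N * ((2 * s * (αc * δ₀)⁻¹) * P * B₀ * L4 * cb))
    (hT₁ : 6 * K₁ * c / a₁ ≤ M) (hT₂ : 6 * K₂ * c / a₂ ≤ M) (hT₃ : 6 * K₃ * c ≤ M) :
    (N * (P * B₀ * L4 * cb * Real.exp (-(asep * δ₀ * D))) + N * (κD * Real.exp (-(2 * δ₀ * D)) * B₀ * L4 * cb) +
      N * ((lip * (αc * δ₀)⁻¹) * P * B₀ * L4 * cb)) * c ≤ 2⁻¹ := by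
  have e₁ : N * (P * B₀ * L4 * cb * Real.exp (-(asep * δ₀ * D))) = K₁ * Real.exp (-(a₁ * M)) := by rw [hD₁, hK₁]; ring
  have e₂ : N * (κD * Real.exp (-(2 * δ₀ * D)) * B₀ * L4 * cb) = K₂ * Real.exp (-(a₂ * M)) := by rw [hD₂, hK₂]; ring
  have e₃ : N * ((lip * (αc * δ₀)⁻¹) * P * B₀ * L4 * cb) = K₃ * M⁻¹ := by rw [hlip, hK₃]; ring
  rw [e₁, e₂, e₃]
  have h₁ := term_exp_small hK₁0 hc ha₁ hM hT₁
  have h₂ := term_exp_small hK₂0 hc ha₂ hM hT₂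
  have h₃ := term_inv_small (K := K₃) hM hT₃
  nlinarith [h₁, h₂, h₃]

variable (i : KIdx d ℓ hd hL b₀ b₁)

omit [Fintype ι] [DecidableEq ι] in
/-- `D_sep = M/(2L²)` with `M = (geo9K i).M = L·M_h`. [cite: Balaban1985BackgroundPropagators, p.411 («a distance MLʲη»), bookkeeping] -/
theorem DsepT_eq_div : DsepT i = (geo9K i).M / (2 * ((ℓ : ℝ) + 1) ^ 2) := by
  show 1 / (2 * ((ℓ : ℝ) + 1) ^ 2) * (((ℓ : ℝ) + 1) * (i.Mh : ℝ)) = (((ℓ + 1 : ℕ) : ℝ)) * (i.Mh : ℝ) / (2 * ((ℓ : ℝ) + 1) ^ 2)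
  push_cast; ring

omit [Fintype ι] [DecidableEq ι] in
/-- `ℓ₁ = 2s_T·M⁻¹`. [cite: Balaban1985BackgroundPropagators, p.412 («small factors O(M⁻¹)»), bookkeeping] -/
theorem lipT_eq : lipT i = 2 * sLipT d ℓ * ((geo9K i).M)⁻¹ := by
  show 2 * sLipT d ℓ / (((ℓ : ℝ) + 1) * (i.Mh : ℝ)) = 2 * sLipT d ℓ * ((((ℓ + 1 : ℕ) : ℝ)) * (i.Mh : ℝ))⁻¹
  push_cast; ring

/-! ## §2 ★★★ (3.48) for `C(U)` at the cube cover of record, «for M sufficiently large» in full -/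

omit i in
/-- ★★★ **THEOREM 3.9 ⇒ THEOREM 3.2 (3.48) FOR `C(U) = (Q′G′²Q′*)⁻¹(U)` AT THE CUBE COVER OF RECORD, FOR EVERY MEMBER ABOVE ONE THRESHOLD, WITH A MEMBER-INDEPENDENT
CONSTANT AND NO LOCATED SMALLNESS** («For M sufficiently large … the operator R is small … This theorem implies Theorem 3.2»): for FILE 12's rate data and constants
`B_G, B₀, κ_D ≧ 0`, `a_sep > 0`, `α_cδ₀ > 0`, the splits and the target rate, there are `M_L` and `K ≧ 0` (`K = 2·3·5^{d+1}·B₀·c₁(d′, ρδ₀, α′)` at the door exponent) such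
that for every member `i` with `M_L ≦ M_i`: from the `EBlock`s of `G′ = O` and of the `G′_□ = Oc □` over the invariant class (M5.5), the section `ιB`, `IsUnit XY`,
contractive transporters, the per-cube local inverse property and un-localized (3.48) blocks of the cube letters `C_□ = Cl □` and the localized [2]-difference majorants
at the cover of record, `conj b ((η²η²)⁻¹•(XinvY i parS O U)) ≺ K·ℓ(a)⁻⁴·e^{−(1−α′)ρδ₀d(a,a′)}` on the block carrier `(t, j) ↦ ιB t`.
[cite: Balaban1985BackgroundPropagators, Thm 3.9 p.413 + (3.95)–(3.97) pp.411–412 + Thm 3.2 (3.48) p.398; Balaban1984PropagatorsII, (2.85)–(2.87) p.238 + Lemma 2.1 (2.66) p.234] -/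
theorem cinv_cover_large [∀ i' : KIdx d ℓ hd hL b₀ b₁, Fintype (geo9K i').Site] [∀ i' : KIdx d ℓ hd hL b₀ b₁, DecidableEq (geo9K i').Site]
    (Rr : KIdx d ℓ hd hL b₀ b₁ → ℝ) (Hp : KIdx d ℓ hd hL b₀ b₁ → Prop) (b : Module.Basis ι ℝ 𝔸)
    {M₂ : ℝ} (hM₂ : 0 ≤ M₂) (hrepr : ∀ (v : 𝔸) (j : ι), |b.repr v j| ≤ M₂ * ‖v‖)
    {δG αG α₂ δ₀ αst bb ρ α' aL aD αc asep BG B₀ κD : ℝ} (hαGδ : 0 < αG * δG) (hα₂0 : 0 < α₂) (hα₂1 : α₂ ≤ 1) (hδG : 0 < (1 - αG) * δG)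
    (hδ₀ : 0 < δ₀) (hρ : 0 < ρ) (hρb : ρ < bb) (hα'0 : 0 < α') (hα'1 : α' ≤ 1) (hαst : 0 < αst)
    (hrate : aL * δ₀ ≤ (1 - α₂) * ((1 - αG) * δG)) (hasep : 0 < asep) (hαc : 0 < αc * δ₀)
    (hsplit₁ : αst + asep + ρ ≤ aL) (hsplit₂ : αst + ρ ≤ aD) (hsplit₃ : αst + αc + ρ ≤ aL) (hBG : 0 ≤ BG) (hB₀ : 0 ≤ B₀) (hκD : 0 ≤ κD) :
    ∃ ML K : ℝ, 0 ≤ K ∧ ∀ i : KIdx d ℓ hd hL b₀ b₁, ML ≤ (geo9K i).M →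
      ∀ {B : B9.Backgrounds} (cfg : B.Cfg → CfgY 𝔸 i) (O : SiteOpY 𝔸 i) (parS : SiteParY 𝔸 i) {U₁ : B.Cfg} (ιB : BlkY i → IBondY i)
        (Oc : ↥(cubes i.D.toDomains) → SiteOpY 𝔸 i)
        (hE : EBlock (kernelFamilySInv i B cfg O parS) BG δG U₁) (hEc : ∀ c, EBlock (kernelFamilySInv i B cfg (Oc c) parS) BG δG U₁)
        (hι : ∀ s, β i.hN i.D i.hk (ιB s) = s) (hunit : IsUnit (XY i parS O (cfg U₁)))
        (hpar : ∀ z w : SiteY i, ‖(parS (cfg U₁) z w : 𝔸)‖ ≤ 1 ∧ ‖(((parS (cfg U₁) z w)⁻¹ : 𝔸ˣ) : 𝔸)‖ ≤ 1)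
        (Cl : ↥(cubes i.D.toDomains) → Module.End ℝ (BlkY i → 𝔸))
        (hloc : ∀ c, (cutMulY (𝔸 := 𝔸) (hB i.D c)).restrictScalars ℝ *
          ((cutMulY (𝔸 := 𝔸) (chiBigT i c)).restrictScalars ℝ * (XY i parS (Oc c) (cfg U₁)).restrictScalars ℝ) * Cl c *
            (cutMulY (𝔸 := 𝔸) (hB i.D c)).restrictScalars ℝ =
          (cutMulY (𝔸 := 𝔸) (hB i.D c)).restrictScalars ℝ * (cutMulY (𝔸 := 𝔸) (hB i.D c)).restrictScalars ℝ)
        (hC : ∀ c, HasMajorant (g := toB6 (geo9K i) (Rr i) (Hp i)) (fun p : BlkY i × ι => ιB p.1) (conj b ((etaS i ^ 2 * etaS i ^ 2)⁻¹ • Cl c))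
          (fun a a' => B₀ * ((geo9K i).len a ^ 4)⁻¹ * Real.exp (-(bb * δ₀ * (geo9K i).dist a a'))))
        (hD : ∀ c, HasMajorant (g := toB6 (geo9K i) (Rr i) (Hp i)) (fun p : BlkY i × ι => ιB p.1)
          (conj b ((etaS i ^ 2 * etaS i ^ 2) • ((cutMulY (𝔸 := 𝔸) (chiBigT i c)).restrictScalars ℝ *
            ((XY i parS O (cfg U₁)).restrictScalars ℝ - (XY i parS (Oc c) (cfg U₁)).restrictScalars ℝ) *
            (cutMulY (𝔸 := 𝔸) (cubeIndT i.D (one_le_Mh i) (four_le_P' i) c)).restrictScalars ℝ)))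
          (fun a a'' => κD * Real.exp (-(2 * δ₀ * DsepT i)) * (geo9K i).len a ^ 4 * Real.exp (-(aD * δ₀ * (geo9K i).dist a a'')))),
        HasMajorant (g := toB6 (geo9K i) (Rr i) (Hp i)) (fun p : BlkY i × ι => ιB p.1)
          (conj b ((etaS i ^ 2 * etaS i ^ 2)⁻¹ • (XinvY i parS O (cfg U₁)).restrictScalars ℝ))
          (fun a a' => K * ((geo9K i).len a ^ 4)⁻¹ * Real.exp (-((1 - α') * (ρ * δ₀) * (geo9K i).dist a a'))) := by
  obtain ⟨ML, d₂, d', h12⟩ := cinv_cover_above (𝔸 := 𝔸) Rr Hp b hM₂ hrepr hαGδ hα₂0 hα₂1 hδG hδ₀ hρ hρb hα'0 hα'1 hαst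
  -- the constants of the three sums (door exponents fixed)
  have hSb : 0 ≤ ∑ j, ‖b j‖ := Finset.sum_nonneg fun _ _ => norm_nonneg _
  have hc0 : 0 ≤ B6.c1 d' (ρ * δ₀) α' := B6RandomWalk.c1_nonneg _ _ _
  have hcb0 : 0 ≤ B6.c1 d' δ₀ (bb - ρ) := B6RandomWalk.c1_nonneg _ _ _
  have hκG0 : 0 ≤ (M₂ * (∑ j, ‖b j‖) * BG) ^ 2 * ((ℓ : ℝ) + 1) ^ 2 * B6.c1 d₂ ((1 - αG) * δG) α₂ :=
    mul_nonneg (mul_nonneg (sq_nonneg _) (pow_nonneg (by positivity) 2)) (B6RandomWalk.c1_nonneg _ _ _)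
  have hP0 : 0 ≤ (M₂ * ∑ j, ‖b j‖) ^ 2 * ((M₂ * (∑ j, ‖b j‖) * BG) ^ 2 * ((ℓ : ℝ) + 1) ^ 2 * B6.c1 d₂ ((1 - αG) * δG) α₂) :=
    mul_nonneg (sq_nonneg _) hκG0
  have hL40 : 0 ≤ ((ℓ : ℝ) + 1) ^ 4 := pow_nonneg (by positivity) 4
  have hN0 : (0 : ℝ) ≤ 3 * 5 ^ (d + 1) := by positivity
  obtain ⟨K₁, hK₁⟩ : ∃ K₁ : ℝ, K₁ = (3 * 5 ^ (d + 1)) *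
      ((M₂ * ∑ j, ‖b j‖) ^ 2 * ((M₂ * (∑ j, ‖b j‖) * BG) ^ 2 * ((ℓ : ℝ) + 1) ^ 2 * B6.c1 d₂ ((1 - αG) * δG) α₂) * B₀ * ((ℓ : ℝ) + 1) ^ 4 *
        B6.c1 d' δ₀ (bb - ρ)) := ⟨_, rfl⟩
  obtain ⟨K₂, hK₂⟩ : ∃ K₂ : ℝ, K₂ = (3 * 5 ^ (d + 1)) * (κD * B₀ * ((ℓ : ℝ) + 1) ^ 4 * B6.c1 d' δ₀ (bb - ρ)) := ⟨_, rfl⟩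
  obtain ⟨K₃, hK₃⟩ : ∃ K₃ : ℝ, K₃ = (3 * 5 ^ (d + 1)) * ((2 * sLipT d ℓ * (αc * δ₀)⁻¹) *
      ((M₂ * ∑ j, ‖b j‖) ^ 2 * ((M₂ * (∑ j, ‖b j‖) * BG) ^ 2 * ((ℓ : ℝ) + 1) ^ 2 * B6.c1 d₂ ((1 - αG) * δG) α₂)) * B₀ * ((ℓ : ℝ) + 1) ^ 4 *
        B6.c1 d' δ₀ (bb - ρ)) := ⟨_, rfl⟩
  have hK₁0 : 0 ≤ K₁ := by rw [hK₁]; exact mul_nonneg hN0 (mul_nonneg (mul_nonneg (mul_nonneg hP0 hB₀) hL40) hcb0)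
  have hK₂0 : 0 ≤ K₂ := by rw [hK₂]; exact mul_nonneg hN0 (mul_nonneg (mul_nonneg (mul_nonneg hκD hB₀) hL40) hcb0)
  have ha₁ : 0 < asep * δ₀ / (2 * ((ℓ : ℝ) + 1) ^ 2) := by positivity
  have ha₂ : 0 < 2 * δ₀ / (2 * ((ℓ : ℝ) + 1) ^ 2) := by positivity
  have hNB : 0 ≤ (3 * 5 ^ (d + 1)) * B₀ * B6.c1 d' (ρ * δ₀) α' := mul_nonneg (mul_nonneg hN0 hB₀) hc0
  refine ⟨max ML (max 1 (max (6 * K₁ * B6.c1 d' (ρ * δ₀) α' / (asep * δ₀ / (2 * ((ℓ : ℝ) + 1) ^ 2)))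
      (max (6 * K₂ * B6.c1 d' (ρ * δ₀) α' / (2 * δ₀ / (2 * ((ℓ : ℝ) + 1) ^ 2))) (6 * K₃ * B6.c1 d' (ρ * δ₀) α')))),
    2 * ((3 * 5 ^ (d + 1)) * B₀ * B6.c1 d' (ρ * δ₀) α'), mul_nonneg zero_le_two hNB, fun i hM => ?_⟩
  intro B cfg O parS U₁ ιB Oc hE hEc hι hunit hpar Cl hloc hC hD
  have hML : ML ≤ (geo9K i).M := (le_max_left _ _).trans hM
  have hM1 : (1 : ℝ) ≤ (geo9K i).M := ((le_max_left _ _).trans (le_max_right _ _)).trans hM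
  have hM0 : 0 < (geo9K i).M := lt_of_lt_of_le one_pos hM1
  have hT₁ : 6 * K₁ * B6.c1 d' (ρ * δ₀) α' / (asep * δ₀ / (2 * ((ℓ : ℝ) + 1) ^ 2)) ≤ (geo9K i).M :=
    (((le_max_left _ _).trans (le_max_right _ _)).trans (le_max_right _ _)).trans hM
  have hT₂ : 6 * K₂ * B6.c1 d' (ρ * δ₀) α' / (2 * δ₀ / (2 * ((ℓ : ℝ) + 1) ^ 2)) ≤ (geo9K i).M :=
    ((((le_max_left _ _).trans (le_max_right _ _)).trans (le_max_right _ _)).trans (le_max_right _ _)).trans hM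
  have hT₃ : 6 * K₃ * B6.c1 d' (ρ * δ₀) α' ≤ (geo9K i).M :=
    ((((le_max_right _ _).trans (le_max_right _ _)).trans (le_max_right _ _)).trans (le_max_right _ _)).trans hM
  have hD₁ : asep * δ₀ * DsepT i = asep * δ₀ / (2 * ((ℓ : ℝ) + 1) ^ 2) * (geo9K i).M := by rw [DsepT_eq_div]; ring
  have hD₂ : 2 * δ₀ * DsepT i = 2 * δ₀ / (2 * ((ℓ : ℝ) + 1) ^ 2) * (geo9K i).M := by rw [DsepT_eq_div]; ring
  -- the located smallness of FILE 12, discharged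
  have hS : ((3 * 5 ^ (d + 1)) * (((M₂ * ∑ j, ‖b j‖) ^ 2 *
        ((M₂ * (∑ j, ‖b j‖) * BG) ^ 2 * ((ℓ : ℝ) + 1) ^ 2 * B6.c1 d₂ ((1 - αG) * δG) α₂)) * B₀ * ((ℓ : ℝ) + 1) ^ 4 * B6.c1 d' δ₀ (bb - ρ) *
        Real.exp (-(asep * δ₀ * DsepT i))) +
      (3 * 5 ^ (d + 1)) * (κD * Real.exp (-(2 * δ₀ * DsepT i)) * B₀ * ((ℓ : ℝ) + 1) ^ 4 * B6.c1 d' δ₀ (bb - ρ)) +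
      (3 * 5 ^ (d + 1)) * ((lipT i * (αc * δ₀)⁻¹) * ((M₂ * ∑ j, ‖b j‖) ^ 2 *
        ((M₂ * (∑ j, ‖b j‖) * BG) ^ 2 * ((ℓ : ℝ) + 1) ^ 2 * B6.c1 d₂ ((1 - αG) * δG) α₂)) * B₀ * ((ℓ : ℝ) + 1) ^ 4 * B6.c1 d' δ₀ (bb - ρ))) *
      B6.c1 d' (ρ * δ₀) α' ≤ 2⁻¹ :=
    smallness_shape hK₁0 hK₂0 hc0 ha₁ ha₂ hM0 hD₁ hD₂ (lipT_eq i) hK₁ hK₂ hK₃ hT₁ hT₂ hT₃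
  have h := h12 i hML cfg O parS ιB Oc hE hEc hBG hι hunit hpar Cl hrate hκD hB₀ hasep.le hαc hsplit₁ hsplit₂ hsplit₃ rfl rfl rfl rfl
    (lt_of_le_of_lt hS (by norm_num)) hloc hC hD
  -- `(1 − (θ₁+θ₂+θ₃)c₁)⁻¹ ≦ 2`
  refine hasMajorant_mono (g := toB6 (geo9K i) (Rr i) (Hp i)) _ h fun a a' => ?_
  set S := ((3 * 5 ^ (d + 1)) * (((M₂ * ∑ j, ‖b j‖) ^ 2 *
        ((M₂ * (∑ j, ‖b j‖) * BG) ^ 2 * ((ℓ : ℝ) + 1) ^ 2 * B6.c1 d₂ ((1 - αG) * δG) α₂)) * B₀ * ((ℓ : ℝ) + 1) ^ 4 * B6.c1 d' δ₀ (bb - ρ) *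
        Real.exp (-(asep * δ₀ * DsepT i))) +
      (3 * 5 ^ (d + 1)) * (κD * Real.exp (-(2 * δ₀ * DsepT i)) * B₀ * ((ℓ : ℝ) + 1) ^ 4 * B6.c1 d' δ₀ (bb - ρ)) +
      (3 * 5 ^ (d + 1)) * ((lipT i * (αc * δ₀)⁻¹) * ((M₂ * ∑ j, ‖b j‖) ^ 2 *
        ((M₂ * (∑ j, ‖b j‖) * BG) ^ 2 * ((ℓ : ℝ) + 1) ^ 2 * B6.c1 d₂ ((1 - αG) * δG) α₂)) * B₀ * ((ℓ : ℝ) + 1) ^ 4 * B6.c1 d' δ₀ (bb - ρ))) *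
      B6.c1 d' (ρ * δ₀) α' with hSdef
  have hX : (1 - S)⁻¹ ≤ 2 := by
    have h2 : (2 : ℝ)⁻¹ ≤ 1 - S := by linarith [hS]
    calc (1 - S)⁻¹ ≤ ((2 : ℝ)⁻¹)⁻¹ := inv_anti₀ (by norm_num) h2
      _ = 2 := inv_inv 2
  have hW : 0 ≤ ((geo9K i).len a ^ 4)⁻¹ * Real.exp (-((1 - α') * (ρ * δ₀) * (geo9K i).dist a a')) :=
    mul_nonneg (inv_nonneg.mpr (pow_nonneg (B6KLevelCensusIndexV1.len_pos i a).le 4)) (Real.exp_nonneg _)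
  calc (3 * 5 ^ (d + 1)) * B₀ * B6.c1 d' (ρ * δ₀) α' * (1 - S)⁻¹ * ((geo9K i).len a ^ 4)⁻¹ *
        Real.exp (-((1 - α') * (ρ * δ₀) * (geo9K i).dist a a'))
      = ((3 * 5 ^ (d + 1)) * B₀ * B6.c1 d' (ρ * δ₀) α' * (1 - S)⁻¹) *
          (((geo9K i).len a ^ 4)⁻¹ * Real.exp (-((1 - α') * (ρ * δ₀) * (geo9K i).dist a a'))) := by ring
    _ ≤ ((3 * 5 ^ (d + 1)) * B₀ * B6.c1 d' (ρ * δ₀) α' * 2) *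
          (((geo9K i).len a ^ 4)⁻¹ * Real.exp (-((1 - α') * (ρ * δ₀) * (geo9K i).dist a a'))) :=
        mul_le_mul_of_nonneg_right (mul_le_mul_of_nonneg_left hX hNB) hW
    _ = 2 * ((3 * 5 ^ (d + 1)) * B₀ * B6.c1 d' (ρ * δ₀) α') * ((geo9K i).len a ^ 4)⁻¹ *
          Real.exp (-((1 - α') * (ρ * δ₀) * (geo9K i).dist a a')) := by ring

end Literature.MathematicalPhysics.QuantumFieldTheory.Balaban1983to89.B9Thm39CinvAtCoverLarge

end
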